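import Mathlib
import Summits.KontsevichZagierPeriods.Zeta5Search.ThirdDigitSeries
import Summits.KontsevichZagierPeriods.Zeta5Search.GHatThirdOrder
import Summits.KontsevichZagierPeriods.Zeta5Search.SecondDigitWProof
import Summits.KontsevichZagierPeriods.Zeta5Search.BigPrimeMinors
import HarnessLib

/-!
# ζ(5) search — third-order transport of the class units and the two harmonic corrections (tools for (V3))

Cell `pub-zeta5` (HONEST FRAMING: systematic search; no irrationality claim unless certified), typer seat generation 12.
Three `p`-adic estimates used by the proof of gen-2 g10's CLASSWISE THIRD-DIGIT LEMMA for `V_x` (`ThirdDigitVProof.lean`,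
REPORT-gen2-g10 §6.2 (V3)):
* `thirdOrder_transport_bound` — moving the units of a class point `s = x + ℓp` to the base `x`:
  `ĝ_s(ρ₃ − pφ_sρ₄ + p²c_sρ₅) ≡ ĝ_x(ρ₃ − pφ_x(ℓρ₃ + ρ₄) + p²c_x(ℓ²ρ₃ + 2ℓρ₄ + ρ₅)) (mod p³)` for `p`-integral `ρ₃, ρ₄, ρ₅`
  (from `padicNorm_gHat_sub_third_le`, `padicNorm_phiHat_sub_second_le`, `padicNorm_curvHat_sub_le` and `φ² − φ₂ = 2c`);
* `corrTwo_bound` — the `σ = 2` harmonic correction: `c_{1,s}N_{s,2} ≡ (−p)^{E+2}ĝ_xH^{(2)}_xρ_{s,2} (mod p^{E+3})`;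
* `corrOne_bound` — the `σ = 1` harmonic correction:
  `c_{0,s}N_{s,1} ≡ (−p)^{E+1}ĝ_x(H_xρ₁ − pφ_xH_x(ℓρ₁ + ρ₂) − pH^{(2)}_xℓρ₁) (mod p^{E+3})`.
Generic `padicNorm` algebra over `ℚ`; nothing here concerns irrationality.
-/

noncomputable section

open Finset

namespace Summit.KontsevichZagierPeriods.Zeta5Search.SecondOrder

open Summit.KontsevichZagierPeriods.Zeta5Search.DualSeries (InBox)
open Summit.KontsevichZagierPeriods.Zeta5Search.CasoratianValuation (InPolytope)
open Summit.KontsevichZagierPeriods.Zeta5Search.ClusterValuation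
open Summit.KontsevichZagierPeriods.Zeta5Search.PadicSeries
open Summit.KontsevichZagierPeriods.Zeta5Search.CellA (gHat_classCongr padicNorm_pow_eq padicNorm_mul_sub_mul_le padicNorm_p)
open Summit.KontsevichZagierPeriods.Zeta5Search.BigPrime (padicNorm_mul_le_one)

variable {p : ℕ} [hp : Fact p.Prime]

/-! ### Small products of `p`-integral numbers -/

/-- `‖a·b‖ ≤ B` when `‖a‖ ≤ B`, `‖b‖ ≤ 1`. -/
theorem padicNorm_mul_le_left {a b : ℚ} {B : ℚ} (ha : padicNorm p a ≤ B) (hb : padicNorm p b ≤ 1) : padicNorm p (a * b) ≤ B := by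
  rw [padicNorm.mul]
  calc padicNorm p a * padicNorm p b ≤ B * 1 :=
        mul_le_mul ha hb (padicNorm.nonneg _) ((padicNorm.nonneg _).trans ha)
    _ = B := mul_one B

/-- `‖a·b‖ ≤ B` when `‖a‖ ≤ 1`, `‖b‖ ≤ B`. -/
theorem padicNorm_mul_le_right {a b : ℚ} {B : ℚ} (ha : padicNorm p a ≤ 1) (hb : padicNorm p b ≤ B) : padicNorm p (a * b) ≤ B := by
  rw [mul_comm]; exact padicNorm_mul_le_left hb ha

/-- `‖p‖ ≤ 1`. -/
theorem padicNorm_p_le_one : padicNorm p (p : ℚ) ≤ 1 := by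
  rw [padicNorm_p]; exact zpow_le_one_of_nonpos₀ one_le_p (by norm_num)

/-- `‖p^k · a‖ ≤ p^{−k}·‖a‖`-type bound: `‖p^k a‖ ≤ p^{-(k : ℤ)} B` for `‖a‖ ≤ B`. -/
theorem padicNorm_p_pow_mul_le {a : ℚ} {B : ℚ} (k : ℕ) (ha : padicNorm p a ≤ B) :
    padicNorm p ((p : ℚ) ^ k * a) ≤ (p : ℚ) ^ (-(k : ℤ)) * B := by
  rw [padicNorm.mul, padicNorm_pow_eq, padicNorm_p]
  have e : ((p : ℚ) ^ (-(1 : ℤ))) ^ k = (p : ℚ) ^ (-(k : ℤ)) := by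
    rw [← zpow_natCast, ← zpow_mul]; congr 1; ring
  rw [e]
  exact mul_le_mul_of_nonneg_left ha (zpow_p_nonneg _)

/-! ### Transport of the class units to third order -/

/-- **Third-order transport.**  For a class point `s` of the class with base `x < p` and `p`-integral `ρ₃, ρ₄, ρ₅`:
`‖ĝ_s(ρ₃ − pφ_sρ₄ + p²c_sρ₅) − ĝ_x(ρ₃ − pφ_x(ℓρ₃ + ρ₄) + p²c_x(ℓ²ρ₃ + 2ℓρ₄ + ρ₅))‖ ≤ p⁻³` (`ℓ = ⌊s/p⌋`). -/
theorem thirdOrder_transport_bound (b : ℕ → ℤ) (hb : InPolytope b) (hp5 : 5 ≤ p) {x s : ℕ} (hx : x < p)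
    (hs : s ∈ classSet b p x) {ρ3 ρ4 ρ5 : ℚ} (hρ3n : padicNorm p ρ3 ≤ 1) (hρ4n : padicNorm p ρ4 ≤ 1) (hρ5n : padicNorm p ρ5 ≤ 1) :
    padicNorm p (gHat b p s * (ρ3 - (p : ℚ) * phiHat b p s * ρ4 + (p : ℚ) ^ 2 * curvHat b p s * ρ5)
      - gHat b p x * (ρ3 - (p : ℚ) * phiHat b p x * (((s / p : ℕ) : ℚ) * ρ3 + ρ4)
          + (p : ℚ) ^ 2 * curvHat b p x * (((s / p : ℕ) : ℚ) ^ 2 * ρ3 + 2 * ((s / p : ℕ) : ℚ) * ρ4 + ρ5))) ≤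
      (p : ℚ) ^ (-(3 : ℤ)) := by
  have hp2 : p ≠ 2 := by omega
  have hp0 : (p : ℚ) ≠ 0 := Nat.cast_ne_zero.2 hp.out.ne_zero
  have hxmem : x ∈ classSet b p x := by
    refine mem_filter.2 ⟨mem_range.2 ?_, rfl⟩
    have := ((mem_classSet_iff b x s).1 hs).1
    have hsx : x ≤ s := by
      have h2 := (mem_filter.1 hs).2
      rw [Nat.mod_eq_of_lt hx] at h2; rw [← h2]; exact Nat.mod_le s p
    omega
  set g := gHat b p x with hg
  set φ := phiHat b p x with hφ
  set φ₂ := phi2Hat b p x with hφ₂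
  set c := curvHat b p x with hc
  set gs := gHat b p s with hgs
  set φs := phiHat b p s with hφs
  set cs := curvHat b p s with hcs
  set ℓ : ℚ := ((s / p : ℕ) : ℚ) with hℓ
  have hφ2c : φ₂ = φ ^ 2 - 2 * c := by rw [hc, curvHat]; ring
  have hgx1 : padicNorm p g ≤ 1 := (padicNorm_gHat_class b hb hp5 hx hxmem hxmem).1
  have hφ1 : padicNorm p φ ≤ 1 := padicNorm_phiHat_le_one b hp2 x
  have hc1 : padicNorm p c ≤ 1 := padicNorm_curvHat_le_one b hp2 x
  have hpn : padicNorm p (p : ℚ) = (p : ℚ) ^ (-(1 : ℤ)) := padicNorm_p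
  have hp1 : padicNorm p (p : ℚ) ≤ 1 := padicNorm_p_le_one
  have hℓn : padicNorm p ℓ ≤ 1 := by rw [hℓ]; simpa using padicNorm.of_nat (p := p) (s / p)
  have hφs1 : padicNorm p φs ≤ 1 := padicNorm_phiHat_le_one b hp2 s
  have hcs1 : padicNorm p cs ≤ 1 := padicNorm_curvHat_le_one b hp2 s
  have hA : padicNorm p (gs - g * (1 - ℓ * p * φ + (ℓ * p) ^ 2 * c)) ≤ (p : ℚ) ^ (-(3 : ℤ)) :=
    padicNorm_gHat_sub_third_le b hp2 hx hs
  have hBφ : padicNorm p (φs - (φ + ℓ * p * φ₂)) ≤ (p : ℚ) ^ (-(2 : ℤ)) := padicNorm_phiHat_sub_second_le b hp2 hx hs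
  have hCc : padicNorm p (cs - c) ≤ (p : ℚ) ^ (-(1 : ℤ)) := padicNorm_curvHat_sub_le b hp2 hx hs
  have hDφ : padicNorm p (φs - φ) ≤ (p : ℚ) ^ (-(1 : ℤ)) := padicNorm_phiHat_sub_le b hp2 hs
  -- the identity
  have hR : (1 - ℓ * p * φ + (ℓ * p) ^ 2 * c) * (ρ3 - p * φs * ρ4 + (p : ℚ) ^ 2 * cs * ρ5)
      - (ρ3 - p * φ * (ℓ * ρ3 + ρ4) + (p : ℚ) ^ 2 * c * (ℓ ^ 2 * ρ3 + 2 * ℓ * ρ4 + ρ5)) =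
      -(p : ℚ) * ((φs - (φ + ℓ * p * φ₂)) * ρ4) + (p : ℚ) ^ 2 * ((cs - c) * ρ5) + (p : ℚ) ^ 2 * (ℓ * φ * (φs - φ) * ρ4)
        + (p : ℚ) ^ 3 * (-ℓ * φ * cs * ρ5 - ℓ ^ 2 * c * φs * ρ4 + ℓ ^ 2 * p * c * cs * ρ5) := by
    rw [hφ2c]; ring
  have e : gs * (ρ3 - (p : ℚ) * φs * ρ4 + (p : ℚ) ^ 2 * cs * ρ5)
      - g * (ρ3 - (p : ℚ) * φ * (ℓ * ρ3 + ρ4) + (p : ℚ) ^ 2 * c * (ℓ ^ 2 * ρ3 + 2 * ℓ * ρ4 + ρ5)) =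
      (gs - g * (1 - ℓ * p * φ + (ℓ * p) ^ 2 * c)) * (ρ3 - (p : ℚ) * φs * ρ4 + (p : ℚ) ^ 2 * cs * ρ5)
        + g * ((1 - ℓ * p * φ + (ℓ * p) ^ 2 * c) * (ρ3 - p * φs * ρ4 + (p : ℚ) ^ 2 * cs * ρ5)
          - (ρ3 - p * φ * (ℓ * ρ3 + ρ4) + (p : ℚ) ^ 2 * c * (ℓ ^ 2 * ρ3 + 2 * ℓ * ρ4 + ρ5))) := by ring
  rw [e, hR]
  -- norms
  have hX : padicNorm p (ρ3 - (p : ℚ) * φs * ρ4 + (p : ℚ) ^ 2 * cs * ρ5) ≤ 1 :=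
    (padicNorm.nonarchimedean (p := p)).trans (max_le ((padicNorm.sub (p := p)).trans (max_le hρ3n
      (padicNorm_mul_le_one (padicNorm_mul_le_one hp1 hφs1) hρ4n)))
      (padicNorm_mul_le_one (padicNorm_mul_le_one (by rw [padicNorm_pow_eq]; exact pow_le_one₀ (padicNorm.nonneg _) hp1) hcs1)
        hρ5n))
  have h1 : padicNorm p (-(p : ℚ) * ((φs - (φ + ℓ * p * φ₂)) * ρ4)) ≤ (p : ℚ) ^ (-(3 : ℤ)) := by
    rw [padicNorm.mul, padicNorm.neg, hpn]
    calc (p : ℚ) ^ (-(1 : ℤ)) * _ ≤ (p : ℚ) ^ (-(1 : ℤ)) * (p : ℚ) ^ (-(2 : ℤ)) :=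
          mul_le_mul_of_nonneg_left (padicNorm_mul_le_left hBφ hρ4n) (zpow_p_nonneg _)
      _ = (p : ℚ) ^ (-(3 : ℤ)) := by rw [← zpow_add₀ hp0]; norm_num
  have h2 : padicNorm p ((p : ℚ) ^ 2 * ((cs - c) * ρ5)) ≤ (p : ℚ) ^ (-(3 : ℤ)) :=
    (padicNorm_p_pow_mul_le 2 (padicNorm_mul_le_left hCc hρ5n)).trans (by rw [← zpow_add₀ hp0]; norm_num)
  have h3 : padicNorm p ((p : ℚ) ^ 2 * (ℓ * φ * (φs - φ) * ρ4)) ≤ (p : ℚ) ^ (-(3 : ℤ)) :=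
    (padicNorm_p_pow_mul_le 2 (padicNorm_mul_le_left (padicNorm_mul_le_right (padicNorm_mul_le_one hℓn hφ1) hDφ) hρ4n)).trans
      (by rw [← zpow_add₀ hp0]; norm_num)
  have h4 : padicNorm p ((p : ℚ) ^ 3 * (-ℓ * φ * cs * ρ5 - ℓ ^ 2 * c * φs * ρ4 + ℓ ^ 2 * p * c * cs * ρ5)) ≤
      (p : ℚ) ^ (-(3 : ℤ)) := by
    have hℓ2 : padicNorm p (ℓ ^ 2) ≤ 1 := by rw [padicNorm_pow_eq]; exact pow_le_one₀ (padicNorm.nonneg _) hℓn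
    have hin : padicNorm p (-ℓ * φ * cs * ρ5 - ℓ ^ 2 * c * φs * ρ4 + ℓ ^ 2 * p * c * cs * ρ5) ≤ 1 :=
      (padicNorm.nonarchimedean (p := p)).trans (max_le ((padicNorm.sub (p := p)).trans (max_le
        (padicNorm_mul_le_one (padicNorm_mul_le_one (padicNorm_mul_le_one (by rw [padicNorm.neg]; exact hℓn) hφ1) hcs1) hρ5n)
        (padicNorm_mul_le_one (padicNorm_mul_le_one (padicNorm_mul_le_one hℓ2 hc1) hφs1) hρ4n)))
        (padicNorm_mul_le_one (padicNorm_mul_le_one (padicNorm_mul_le_one (padicNorm_mul_le_one hℓ2 hp1) hc1) hcs1) hρ5n))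
    exact (padicNorm_p_pow_mul_le 3 hin).trans (by rw [mul_one]; norm_num)
  refine (padicNorm.nonarchimedean (p := p)).trans (max_le (padicNorm_mul_le_left hA hX) ?_)
  refine padicNorm_mul_le_right hgx1 ?_
  exact (padicNorm.nonarchimedean (p := p)).trans (max_le ((padicNorm.nonarchimedean (p := p)).trans
    (max_le ((padicNorm.nonarchimedean (p := p)).trans (max_le h1 h2)) h3)) h4)

/-! ### The two harmonic corrections -/

/-- **`σ = 2` correction**: `‖cN − (−p)^{E+2}gH₂ρ‖ ≤ p^{−(E+3)}` when `c ≡ (−p)^{E+2}g'ρ (mod p^{E+3})`, `g' ≡ g`, `N ≡ H₂ (mod p)`. -/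
theorem corrTwo_bound {c gs g ρ N H2 : ℚ} {E : ℤ} (hc : padicNorm p (c - (-(p : ℚ)) ^ (E + 2) * gs * ρ) ≤ (p : ℚ) ^ (-(E + 3)))
    (hN : padicNorm p N ≤ 1) (hρ : padicNorm p ρ ≤ 1) (hg : padicNorm p g ≤ 1)
    (hgs : padicNorm p (gs - g) ≤ (p : ℚ) ^ (-(1 : ℤ))) (hNH : padicNorm p (N - H2) ≤ (p : ℚ) ^ (-(1 : ℤ))) :
    padicNorm p (c * N - (-(p : ℚ)) ^ (E + 2) * g * H2 * ρ) ≤ (p : ℚ) ^ (-(E + 3)) := by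
  have hp0 : (p : ℚ) ≠ 0 := Nat.cast_ne_zero.2 hp.out.ne_zero
  have hp' : (-(p : ℚ)) ≠ 0 := neg_ne_zero.2 hp0
  have hpow : padicNorm p ((-(p : ℚ)) ^ (E + 2)) = (p : ℚ) ^ (-(E + 2)) := by
    rw [padicNorm.eq_zpow_of_nonzero (zpow_ne_zero _ hp'), padicValRat.zpow, padicValRat.neg,
      padicValRat.self hp.out.one_lt, mul_one]
  have e : c * N - (-(p : ℚ)) ^ (E + 2) * g * H2 * ρ = (c - (-(p : ℚ)) ^ (E + 2) * gs * ρ) * N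
      + (-(p : ℚ)) ^ (E + 2) * ((gs - g) * ρ * N + g * ρ * (N - H2)) := by ring
  rw [e]
  refine (padicNorm.nonarchimedean (p := p)).trans (max_le (padicNorm_mul_le_left hc hN) ?_)
  rw [padicNorm.mul, hpow]
  have hin : padicNorm p ((gs - g) * ρ * N + g * ρ * (N - H2)) ≤ (p : ℚ) ^ (-(1 : ℤ)) :=
    (padicNorm.nonarchimedean (p := p)).trans (max_le (padicNorm_mul_le_left (padicNorm_mul_le_left hgs hρ) hN)
      (padicNorm_mul_le_right (padicNorm_mul_le_one hg hρ) hNH))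
  calc (p : ℚ) ^ (-(E + 2)) * _ ≤ (p : ℚ) ^ (-(E + 2)) * (p : ℚ) ^ (-(1 : ℤ)) := mul_le_mul_of_nonneg_left hin (zpow_p_nonneg _)
    _ = (p : ℚ) ^ (-(E + 3)) := by rw [← zpow_add₀ hp0]; ring_nf

/-- **`σ = 1` correction**: with `c ≡ (−p)^{E+1}g'(ρ − pφ'ρ') (mod p^{E+3})`, `N ≡ H − ℓpH₂ (mod p²)`, `g' ≡ g(1 − ℓpφ) (mod p²)`,
`φ' ≡ φ (mod p)`: `‖cN − (−p)^{E+1}g(Hρ − pφH(ℓρ + ρ') − pH₂ℓρ)‖ ≤ p^{−(E+3)}`. -/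
theorem corrOne_bound {c gs g ρ ρ' N H H2 φ φs ℓ : ℚ} {E : ℤ}
    (hc : padicNorm p (c - (-(p : ℚ)) ^ (E + 1) * gs * (ρ - (p : ℚ) * φs * ρ')) ≤ (p : ℚ) ^ (-(E + 3)))
    (hN : padicNorm p N ≤ 1) (hνN : padicNorm p (N - (H - ℓ * p * H2)) ≤ (p : ℚ) ^ (-(2 : ℤ)))
    (hε : padicNorm p (gs - g * (1 - ℓ * p * φ)) ≤ (p : ℚ) ^ (-(2 : ℤ))) (hδ : padicNorm p (φs - φ) ≤ (p : ℚ) ^ (-(1 : ℤ)))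
    (hgs1 : padicNorm p gs ≤ 1) (hg : padicNorm p g ≤ 1) (hρ : padicNorm p ρ ≤ 1) (hρ' : padicNorm p ρ' ≤ 1)
    (hH : padicNorm p H ≤ 1) (hH2 : padicNorm p H2 ≤ 1) (hφ : padicNorm p φ ≤ 1) (hφs : padicNorm p φs ≤ 1)
    (hℓ : padicNorm p ℓ ≤ 1) :
    padicNorm p (c * N - (-(p : ℚ)) ^ (E + 1) * g * (H * ρ - (p : ℚ) * φ * H * (ℓ * ρ + ρ') - (p : ℚ) * H2 * ℓ * ρ)) ≤
      (p : ℚ) ^ (-(E + 3)) := by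
  have hp0 : (p : ℚ) ≠ 0 := Nat.cast_ne_zero.2 hp.out.ne_zero
  have hp' : (-(p : ℚ)) ≠ 0 := neg_ne_zero.2 hp0
  have hp1 : padicNorm p (p : ℚ) ≤ 1 := padicNorm_p_le_one
  have hpn : padicNorm p (p : ℚ) = (p : ℚ) ^ (-(1 : ℤ)) := padicNorm_p
  have hpow : padicNorm p ((-(p : ℚ)) ^ (E + 1)) = (p : ℚ) ^ (-(E + 1)) := by
    rw [padicNorm.eq_zpow_of_nonzero (zpow_ne_zero _ hp'), padicValRat.zpow, padicValRat.neg,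
      padicValRat.self hp.out.one_lt, mul_one]
  -- the identity
  have e : c * N - (-(p : ℚ)) ^ (E + 1) * g * (H * ρ - (p : ℚ) * φ * H * (ℓ * ρ + ρ') - (p : ℚ) * H2 * ℓ * ρ) =
      (c - (-(p : ℚ)) ^ (E + 1) * gs * (ρ - (p : ℚ) * φs * ρ')) * N
      + (-(p : ℚ)) ^ (E + 1) * (gs * (ρ - (p : ℚ) * φs * ρ') * (N - (H - ℓ * p * H2))
          + (gs - g * (1 - ℓ * p * φ)) * (ρ - (p : ℚ) * φs * ρ') * (H - ℓ * p * H2)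
          + g * (-(p : ℚ) * ((φs - φ) * ρ' * H)
              + (p : ℚ) ^ 2 * (ℓ * φ * φs * ρ' * H + ℓ * H2 * φs * ρ' + ℓ ^ 2 * φ * ρ * H2 - ℓ ^ 2 * p * φ * φs * ρ' * H2))) := by
    ring
  rw [e]
  refine (padicNorm.nonarchimedean (p := p)).trans (max_le (padicNorm_mul_le_left hc hN) ?_)
  rw [padicNorm.mul, hpow]
  -- norms of the pieces
  have hY : padicNorm p (ρ - (p : ℚ) * φs * ρ') ≤ 1 :=
    (padicNorm.sub (p := p)).trans (max_le hρ (padicNorm_mul_le_one (padicNorm_mul_le_one hp1 hφs) hρ'))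
  have hZ : padicNorm p (H - ℓ * p * H2) ≤ 1 :=
    (padicNorm.sub (p := p)).trans (max_le hH (padicNorm_mul_le_one (padicNorm_mul_le_one hℓ hp1) hH2))
  have h1 : padicNorm p (gs * (ρ - (p : ℚ) * φs * ρ') * (N - (H - ℓ * p * H2))) ≤ (p : ℚ) ^ (-(2 : ℤ)) :=
    padicNorm_mul_le_right (padicNorm_mul_le_one hgs1 hY) hνN
  have h2 : padicNorm p ((gs - g * (1 - ℓ * p * φ)) * (ρ - (p : ℚ) * φs * ρ') * (H - ℓ * p * H2)) ≤ (p : ℚ) ^ (-(2 : ℤ)) :=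
    padicNorm_mul_le_left (padicNorm_mul_le_left hε hY) hZ
  have h3 : padicNorm p (g * (-(p : ℚ) * ((φs - φ) * ρ' * H)
      + (p : ℚ) ^ 2 * (ℓ * φ * φs * ρ' * H + ℓ * H2 * φs * ρ' + ℓ ^ 2 * φ * ρ * H2 - ℓ ^ 2 * p * φ * φs * ρ' * H2))) ≤
      (p : ℚ) ^ (-(2 : ℤ)) := by
    refine padicNorm_mul_le_right hg ((padicNorm.nonarchimedean (p := p)).trans (max_le ?_ ?_))
    · rw [padicNorm.mul, padicNorm.neg, hpn]
      calc (p : ℚ) ^ (-(1 : ℤ)) * _ ≤ (p : ℚ) ^ (-(1 : ℤ)) * (p : ℚ) ^ (-(1 : ℤ)) :=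
            mul_le_mul_of_nonneg_left (padicNorm_mul_le_left (padicNorm_mul_le_left hδ hρ') hH) (zpow_p_nonneg _)
        _ = (p : ℚ) ^ (-(2 : ℤ)) := by rw [← zpow_add₀ hp0]; norm_num
    · have hℓ2 : padicNorm p (ℓ ^ 2) ≤ 1 := by rw [padicNorm_pow_eq]; exact pow_le_one₀ (padicNorm.nonneg _) hℓ
      have hin : padicNorm p (ℓ * φ * φs * ρ' * H + ℓ * H2 * φs * ρ' + ℓ ^ 2 * φ * ρ * H2 - ℓ ^ 2 * p * φ * φs * ρ' * H2) ≤ 1 :=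
        (padicNorm.sub (p := p)).trans (max_le ((padicNorm.nonarchimedean (p := p)).trans (max_le
          ((padicNorm.nonarchimedean (p := p)).trans (max_le
            (padicNorm_mul_le_one (padicNorm_mul_le_one (padicNorm_mul_le_one (padicNorm_mul_le_one hℓ hφ) hφs) hρ') hH)
            (padicNorm_mul_le_one (padicNorm_mul_le_one (padicNorm_mul_le_one hℓ hH2) hφs) hρ')))
          (padicNorm_mul_le_one (padicNorm_mul_le_one (padicNorm_mul_le_one hℓ2 hφ) hρ) hH2)))
          (padicNorm_mul_le_one (padicNorm_mul_le_one (padicNorm_mul_le_one (padicNorm_mul_le_one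
            (padicNorm_mul_le_one hℓ2 hp1) hφ) hφs) hρ') hH2))
      exact (padicNorm_p_pow_mul_le 2 hin).trans (by rw [mul_one]; norm_num)
  have hin : padicNorm p (gs * (ρ - (p : ℚ) * φs * ρ') * (N - (H - ℓ * p * H2))
      + (gs - g * (1 - ℓ * p * φ)) * (ρ - (p : ℚ) * φs * ρ') * (H - ℓ * p * H2)
      + g * (-(p : ℚ) * ((φs - φ) * ρ' * H)
          + (p : ℚ) ^ 2 * (ℓ * φ * φs * ρ' * H + ℓ * H2 * φs * ρ' + ℓ ^ 2 * φ * ρ * H2 - ℓ ^ 2 * p * φ * φs * ρ' * H2))) ≤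
      (p : ℚ) ^ (-(2 : ℤ)) :=
    (padicNorm.nonarchimedean (p := p)).trans (max_le ((padicNorm.nonarchimedean (p := p)).trans (max_le h1 h2)) h3)
  calc (p : ℚ) ^ (-(E + 1)) * _ ≤ (p : ℚ) ^ (-(E + 1)) * (p : ℚ) ^ (-(2 : ℤ)) := mul_le_mul_of_nonneg_left hin (zpow_p_nonneg _)
    _ = (p : ℚ) ^ (-(E + 3)) := by rw [← zpow_add₀ hp0]; ring_nf

end Summit.KontsevichZagierPeriods.Zeta5Search.SecondOrder

end
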